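import Literature.Analysis.ODE.ElementaryFieldEnclosureCertificate
import Literature.Analysis.ODE.HighOrderChainCertificate
import HarnessLib

/-!
# Kernel-checkable chains of enclosure steps for elementary fields (continuation over a mesh)

Topic `Literature/Analysis/ODE`. R. E. Moore, *Methods and Applications of Interval Analysis*
(SIAM 1979): §3.4 (the *derived program* of a code list — recursion relations (3.17)–(3.19) for
the Taylor coefficients of `+ − × ÷`, powers, `exp`, `log`, `sin`/`cos`, `√`, evaluated "in
rounded interval arithmetic", procedure steps 1–4) and §8.1 p. 83 (having validated `[0, t₁]`
and obtained the interval value `X^{(N)}(t₁)` of (8.10), "we can *continue* the interval solution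
… from the new, *interval* initial conditions", the test (8.5) in its interval-initial-value form
(8.13)); N. S. Nedialkov, K. R. Jackson, G. F. Corliss 1999 §5, Algorithm I iterated over the mesh
(validate step `j` from the box `Wⱼ`, hand the end enclosure over as `W_{j+1}`), the Taylor
coefficients being generated by automatic differentiation of the field's code list (§3 there).
`HighOrderChainCertificate.lean` made the whole transcript of such a computation a single `Bool`
for POLYNOMIAL fields; `ElementaryFieldEnclosureCertificate.lean` made ONE step a `Bool` for
ELEMENTARY fields (code lists `FExpr` with `exp`, `log`, `sin`, `cos`, `inv`, `÷`, `√`, whose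
natural domain is certified by the order-`1` run of the derived program). This file chains the
latter along the mesh of the former:

* `HOEStage.toECert` reads a stage (order `Kⱼ`, step `hⱼ`, box `Wⱼ`, a-priori box `Sⱼ`) as an
  elementary step certificate `EStepCert` for the code lists `F` and the precision parameters
  `cfg` of the derived program; `EChainCert n` = `F`, `cfg`, the list of stages and the claimed
  final box `W_N`; `EChainCert.toHOEChain` is the underlying mesh transcript (boxes and steps),
  whose mesh `τⱼ = h₀ + ⋯ + h_{j-1}` and bookkeeping (`HOEChainCert.mesh`, `stageAt`, `initAt`)
  are REUSED;
* `EChainCert.check` runs, for every stage, `EStepCert.check` (both runs of the derived program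
  succeed — which certifies `Sⱼ ⊆ dom f` — and the HOE inclusion (8.10) ⊆ `Sⱼ` holds in rational
  interval arithmetic) AND the landing test `endBoxⱼ ⊆ W_{j+1}` (`boxLE`), `W_N` = the final box;
* `EChainCert.sound`: if `check = true` then from every real `y₀ ∈ W₀` a solution of `y' = f(y)`
  exists on `[0, τ_N]`, and EVERY solution from `y₀` satisfies `y(τⱼ) ∈ Wⱼ` (`j ≤ N`), `y(t) ∈ Sⱼ`
  and the Taylor-tube identity `y(t) = ∑_{i<Kⱼ} (t−τⱼ)ⁱ Φᵢ(y(τⱼ)) + (t−τⱼ)^{Kⱼ} v`, `v ∈ Vⱼ`, on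
  `[τⱼ, τⱼ₊₁]` — the abstract chain theorems `exists_solution_of_stepChain` /
  `solution_mem_of_stepChain` (`StepChain.lean`) fed with `EStepCert.sound` per step and the
  algebraic landing `∑ hⱼⁱ Φᵢ(x) + hⱼ^K v ∈ endBoxⱼ ⊆ W_{j+1}` (`taylorSum_mem_hoeBox` with
  `EStepCert.mapsTo_coeffBox`); here `Φᵢ = (1/i!) L_f^i Id` are the flow Taylor coefficient maps
  of the smooth field on its open natural domain (`smoothTaylorMap (contDiffOn_fieldFun F)`);
  `mem_final` is the end enclosure `y(τ_N) ∈ W_N`, and `mem_dom` the DOMAIN certificate along the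
  whole horizon: no solution from `W₀` reaches a singularity of the field (a zero of a
  denominator, a non-positive argument of `log`/`√`) on `[0, τ_N]` (Moore 1979 §3.4, last
  paragraph: the derived program can only be carried out where the operations are defined — here
  turned around into a certificate);
* `eChainVerifier`: the same as a `ValidatedNumerics.Verifier` (instance = code lists, initial
  box, horizon, final box; certificate = precision parameters + the list of stages found by an
  untrusted integrator).

WORKED EXAMPLE (kernel): the pendulum `x₁' = x₂`, `x₂' = −sin x₁` (`pendulumField`) from
`x(0) = (1, 0)`, EIGHT steps of `h = 1/8` at order `6` to `t = 1`, derived program with `40`-bit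
outward rounding and `sin`/`cos` seeds at scale `2^30` (`12` terms, `3` halvings); the a-priori
boxes and the hand-over boxes (end boxes rounded outward to `10⁻⁷`) were produced by an untrusted
search (`pendulumChain`): `pendulumChain_check : pendulumChain.check = true := by decide +kernel`,
whence `pendulumChain_exists` (a solution on `[0, 1]`), `pendulumChain_final` (every solution from
`(1, 0)` has `x(1) ∈ [0.6000848, 0.6000863] × [−0.7549644, −0.7549629]`; a reference integration
gives `x(1) = (0.60008537…, −0.75496371…)`) and `pendulumChain_half` (`x(1/2) ∈ W₄ =
[0.8960323, 0.8960329] × [−0.4108787, −0.4108782]`). The hand-over widths grow from `1·10⁻⁷` to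
`1.5·10⁻⁶` over the eight steps (outward rounding to `10⁻⁷` per step plus the mild wrapping of the
direct method, Moore pp. 83–84). Exact rational arithmetic throughout (Moore 1966 §4.4); no facts,
no axioms beyond the standard three, no `sorry`.

## References

* R. E. Moore, *Methods and Applications of Interval Analysis*, SIAM 1979, §3.4 eqs.
  (3.17)–(3.19) and procedure steps 1–4; §8.1 eqs. (8.5), (8.10), (8.13) and pp. 83–84.
  [held: lit key book:moorend-methods-applications-interval-analysis]
* N. S. Nedialkov, K. R. Jackson, G. F. Corliss, *Validated solutions of initial value problems
  for ordinary differential equations*, Appl. Math. Comput. 105 (1999) 21–68, §3 (automatic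
  generation of Taylor coefficients), §5 Algorithm I.
* N. S. Nedialkov, K. R. Jackson, J. D. Pryce, *An effective high-order interval method for
  validating existence and uniqueness of the solution of an IVP for an ODE*, Reliable Computing 7
  (2001), §3.
* R. E. Moore, *Interval Analysis*, Prentice-Hall 1966, §4.4, Ch. 11.
-/

open Set NonemptyInterval
open Literature.Analysis.ValidatedNumerics Literature.Analysis.ValidatedNumerics.ITaylor

namespace Literature.Analysis.ODE

open FExpr

/-! ### Stages and the chain checker -/

section Chain

variable {n : ℕ}

/-- A stage (order `Kⱼ`, step `hⱼ`, box `Wⱼ`, a-priori box `Sⱼ`) read as the **elementary step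
certificate** of the code lists `F` with the precision parameters `cfg` of the derived program.
[cite: Moore1979, §8.1 eq. (8.13)] [cite: Moore1979, §3.4 procedure steps 1–4] -/
def HOEStage.toECert (F : Fin n → FExpr n) (cfg : SeedCfg) (s : HOEStage n) : EStepCert n :=
  ⟨F, s.order, s.step, s.init, s.apriori, cfg⟩

/-- **The chain checker** on a list of stages of an elementary field: every stage passes the
elementary step certificate check (derived program over `Wⱼ` and `Sⱼ`, HOE inclusion ⊆ `Sⱼ`) and
its end box lands in the next initial box (in the final box for the last stage).
[cite: Moore1979, §8.1 eq. (8.13)] [cite: NedialkovJacksonCorliss1999, §5 Algorithm I] -/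
def eChainCheck (F : Fin n → FExpr n) (cfg : SeedCfg) (fin : Fin n → Iv) : List (HOEStage n) → Bool
  | [] => true
  | s :: rest =>
      (s.toECert F cfg).check && boxLE (s.toECert F cfg).endBox (nextInit fin rest) &&
        eChainCheck F cfg fin rest

/-- A **step-chain certificate for an elementary field**: the code lists of the components of `f`,
the precision parameters of the derived program, the stages, and the claimed enclosure `W_N` of
the values at the end of the mesh. [cite: Moore1979, §8.1 eq. (8.13)]
[cite: Moore1979, §3.4 procedure steps 1–4] [cite: NedialkovJacksonCorliss1999, §5 Algorithm I] -/
structure EChainCert (n : ℕ) where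
  /-- The vector field, one code list per component. -/
  field : Fin n → FExpr n
  /-- Precision parameters of the derived program (shared by all stages). -/
  cfg : SeedCfg
  /-- The stages, in temporal order. -/
  stages : List (HOEStage n)
  /-- The claimed final box `W_N ∋ y(τ_N)`. -/
  final : Fin n → Iv

namespace EChainCert

variable (c : EChainCert n)

/-- Number of steps `N`. [cite: NedialkovJacksonCorliss1999, §5 Algorithm I] -/
def size : ℕ := c.stages.length

/-- **The underlying mesh transcript** (`HighOrderChainCertificate.lean`): the same stages and
final box; its polynomial field slot plays no role for the mesh and is left empty.  Its mesh
`τⱼ = h₀ + ⋯ + h_{j-1}` (`HOEChainCert.mesh` / `meshQ`), stages `stageAt j` (padding stage past the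
end) and boxes `initAt j` (`W_N` = the final box) are REUSED for the elementary chain; its own
`check` is not. [cite: Moore1979, §8.1 eq. (8.13)] [cite: NedialkovJacksonCorliss1999, §5 Algorithm I] -/
def toHOEChain : HOEChainCert n := ⟨fun _ => [], c.stages, c.final⟩

/-- Stage `j` (the padding stage — order `0`, step `0`, both boxes the final box — for `j ≥ N`).
[cite: NedialkovJacksonCorliss1999, §5 Algorithm I] -/
def stageAt (j : ℕ) : HOEStage n := c.toHOEChain.stageAt j

/-- The elementary step certificate of stage `j`. [cite: Moore1979, §8.1 eqs. (8.10), (8.13)] -/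
def certAt (j : ℕ) : EStepCert n := (c.stageAt j).toECert c.field c.cfg

/-- The box `Wⱼ` at mesh point `j` (`W_N` = the final box). [cite: Moore1979, §8.1 eq. (8.13)] -/
def initAt (j : ℕ) : Fin n → Iv := c.toHOEChain.initAt j

/-- **The checker** of an elementary step-chain certificate. [cite: Moore1979, §8.1 eq. (8.13)]
[cite: NedialkovJacksonCorliss1999, §5 Algorithm I] -/
def check : Bool := eChainCheck c.field c.cfg c.final c.stages

variable {c}

/-- What the chain checker establishes, stage by stage. [cite: NedialkovJacksonCorliss1999, §5 Algorithm I] -/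
theorem eChainCheck_spec {F : Fin n → FExpr n} {cfg : SeedCfg} {fin : Fin n → Iv} :
    ∀ (l : List (HOEStage n)), eChainCheck F cfg fin l = true → ∀ j < l.length,
      ((l.getD j (⟨0, 0, fin, fin⟩ : HOEStage n)).toECert F cfg).check = true ∧
        boxLE ((l.getD j (⟨0, 0, fin, fin⟩ : HOEStage n)).toECert F cfg).endBox
          (l.getD (j + 1) (⟨0, 0, fin, fin⟩ : HOEStage n)).init = true
  | [], _, j, hj => absurd hj (Nat.not_lt_zero j)
  | s :: rest, h, j, hj => by
      simp only [eChainCheck, Bool.and_eq_true] at h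
      obtain ⟨⟨h1, h2⟩, h3⟩ := h
      cases j with
      | zero =>
          refine ⟨by simpa using h1, ?_⟩
          cases rest with
          | nil => simpa [nextInit] using h2
          | cons s' rest' => simpa [nextInit] using h2
      | succ j =>
          simp only [List.getD_cons_succ]
          exact eChainCheck_spec rest h3 j (by simpa using hj)

/-- Stage `j < N` of an accepted chain: its elementary step certificate is accepted and its end
box lands in `W_{j+1}`. [cite: NedialkovJacksonCorliss1999, §5 Algorithm I] -/
theorem check_stage (hc : c.check = true) {j : ℕ} (hj : j < c.size) :
    ((c.stageAt j).toECert c.field c.cfg).check = true ∧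
      boxLE ((c.stageAt j).toECert c.field c.cfg).endBox (c.initAt (j + 1)) = true :=
  eChainCheck_spec c.stages hc j hj

/-- **The landing step**: for `x ∈ Wⱼ` and `v ∈ Vⱼ`, the Taylor sum at `hⱼ` lies in `W_{j+1}`
(`∈ endBoxⱼ ⊆ W_{j+1}`; the coefficient boxes of the derived program enclose `Φᵢ(Wⱼ)`).
[cite: Moore1979, §8.1 eqs. (8.10), (8.13)] [cite: Moore1979, §3.4 eqs. (3.17)–(3.19)] -/
theorem landing (hc : c.check = true) {j : ℕ} (hj : j < c.size) {x : Fin n → ℝ}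
    (hx : x ∈ boxSet (castBox (c.initAt j))) {v : Fin n → ℝ}
    (hv : v ∈ boxSet (castBox (c.certAt j).remBox)) :
    (∑ i ∈ Finset.range (c.stageAt j).order,
        ((c.stageAt j).step : ℝ) ^ i • smoothTaylorMap (contDiffOn_fieldFun c.field) i x) +
      ((c.stageAt j).step : ℝ) ^ (c.stageAt j).order • v ∈ boxSet (castBox (c.initAt (j + 1))) := by
  obtain ⟨hcj, hland⟩ := check_stage hc hj
  refine boxSet_mono (castBox_mono (le_of_boxLE hland)) ?_
  rw [EStepCert.endBox, castBox_hoeBoxQ, ratCast_pure]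
  exact taylorSum_mem_hoeBox (mem_pure_self _)
    (fun i hi => EStepCert.mapsTo_coeffBox hcj hi hx) hv

/-- **Soundness of the elementary step-chain certificate** (Moore 1979 §8.1 (8.13): continuation
from the interval initial conditions, the Taylor coefficients of every step generated by the
derived program of §3.4; NJC 1999 Algorithm I over the mesh). If `check` accepts, then from
every `y₀ ∈ W₀` a solution of `y' = f(y)` exists on `[0, τ_N]`, and EVERY solution `y` from `y₀`
on `[0, τ_N]` satisfies `y(τⱼ) ∈ Wⱼ` for `j ≤ N` and, on each `[τⱼ, τⱼ₊₁]`, `y(t) ∈ Sⱼ` and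
`y(t) = ∑_{i<Kⱼ} (t-τⱼ)ⁱ Φᵢ(y(τⱼ)) + (t-τⱼ)^{Kⱼ} v` with `v ∈ Vⱼ = remBoxⱼ`, where
`Φᵢ = (1/i!) L_f^i Id` on the natural domain of the field.
[cite: Moore1979, §8.1 eq. (8.13)] [cite: Moore1979, §3.4 eqs. (3.17)–(3.19)]
[cite: NedialkovJacksonCorliss1999, §5 Algorithm I] -/
theorem sound (hc : c.check = true) {y₀ : Fin n → ℝ} (hy₀ : y₀ ∈ boxSet (castBox (c.initAt 0))) :
    (∃ y : ℝ → Fin n → ℝ, y 0 = y₀ ∧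
        ∀ t ∈ Icc 0 (c.toHOEChain.mesh c.size),
          HasDerivWithinAt y (fieldFun c.field (y t)) (Icc 0 (c.toHOEChain.mesh c.size)) t) ∧
      ∀ y : ℝ → Fin n → ℝ, y 0 = y₀ →
        (∀ t ∈ Icc 0 (c.toHOEChain.mesh c.size),
            HasDerivWithinAt y (fieldFun c.field (y t)) (Icc 0 (c.toHOEChain.mesh c.size)) t) →
          (∀ j ≤ c.size, y (c.toHOEChain.mesh j) ∈ boxSet (castBox (c.initAt j))) ∧
            ∀ j < c.size, ∀ t ∈ Icc (c.toHOEChain.mesh j) (c.toHOEChain.mesh (j + 1)),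
              y t ∈ boxSet (castBox (c.stageAt j).apriori) ∧
                ∃ v ∈ boxSet (castBox (c.certAt j).remBox),
                  y t = (∑ i ∈ Finset.range (c.stageAt j).order,
                      (t - c.toHOEChain.mesh j) ^ i •
                        smoothTaylorMap (contDiffOn_fieldFun c.field) i (y (c.toHOEChain.mesh j))) +
                    (t - c.toHOEChain.mesh j) ^ (c.stageAt j).order • v := by
  -- the per-step enclosure relation of the abstract chain theorems
  set Q : ℕ → ℝ → (Fin n → ℝ) → (Fin n → ℝ) → Prop := fun j s x w =>
    w ∈ boxSet (castBox (c.stageAt j).apriori) ∧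
      ∃ v ∈ boxSet (castBox (c.certAt j).remBox),
        w = (∑ i ∈ Finset.range (c.stageAt j).order,
            s ^ i • smoothTaylorMap (contDiffOn_fieldFun c.field) i x) +
          s ^ (c.stageAt j).order • v with hQ
  set τ : ℕ → ℝ := c.toHOEChain.mesh
  have hτ0 : τ 0 = 0 := HOEChainCert.mesh_zero
  have hτs : ∀ j, τ (j + 1) - τ j = ((c.stageAt j).step : ℝ) := fun j =>
    HOEChainCert.mesh_step (c := c.toHOEChain) j
  have hτ : ∀ j < c.size, τ j ≤ τ (j + 1) := fun j hj => by
    show c.toHOEChain.mesh j ≤ c.toHOEChain.mesh (j + 1)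
    rw [HOEChainCert.mesh_succ]
    exact le_add_of_nonneg_right (EStepCert.check_spec (check_stage hc hj).1).2.1
  have hall : ∀ j < c.size, ∀ x ∈ boxSet (castBox (c.initAt j)), ∀ z : ℝ → Fin n → ℝ, z 0 = x →
      (∀ s ∈ Icc 0 (τ (j + 1) - τ j),
        HasDerivWithinAt z (fieldFun c.field (z s)) (Icc 0 (τ (j + 1) - τ j)) s) →
      ∀ s ∈ Icc 0 (τ (j + 1) - τ j), Q j s x (z s) := by
    intro j hj x hx z hz0 hz s hs
    rw [hτs] at hz hs
    exact ((c.certAt j).sound (check_stage hc hj).1 hx).2 z hz0 hz s hs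
  have hland : ∀ j < c.size, ∀ x ∈ boxSet (castBox (c.initAt j)), ∀ w,
      Q j (τ (j + 1) - τ j) x w → w ∈ boxSet (castBox (c.initAt (j + 1))) := by
    intro j hj x hx w hw
    obtain ⟨-, v, hv, rfl⟩ := hw
    rw [hτs]
    exact landing hc hj hx hv
  refine ⟨?_, fun y hy0 hy => ?_⟩
  · have hstep : ∀ j < c.size, ∀ x ∈ boxSet (castBox (c.initAt j)), ∃ z : ℝ → Fin n → ℝ, z 0 = x ∧
        (∀ s ∈ Icc 0 (τ (j + 1) - τ j),
          HasDerivWithinAt z (fieldFun c.field (z s)) (Icc 0 (τ (j + 1) - τ j)) s) ∧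
        ∀ s ∈ Icc 0 (τ (j + 1) - τ j), Q j s x (z s) := by
      intro j hj x hx
      obtain ⟨⟨z, hz0, hz⟩, -⟩ := (c.certAt j).sound (check_stage hc hj).1 hx
      refine ⟨z, hz0, ?_, ?_⟩
      · rw [hτs]; exact hz
      · exact hall j hj x hx z hz0 (by rw [hτs]; exact hz)
    obtain ⟨y, hy0, hy, -, -⟩ :=
      exists_solution_of_stepChain (f := fieldFun c.field) (W := fun j => boxSet (castBox (c.initAt j)))
        (Q := Q) c.size hτ0 hτ hstep hland hy₀
    exact ⟨y, hy0, hy⟩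
  · have hyW : y 0 ∈ boxSet (castBox (c.initAt 0)) := hy0 ▸ hy₀
    obtain ⟨hW, hQ'⟩ :=
      solution_mem_of_stepChain (f := fieldFun c.field) (W := fun j => boxSet (castBox (c.initAt j)))
        (Q := Q) c.size hτ0 hτ hall hland hyW hy
    exact ⟨hW, fun j hj t ht => hQ' j hj t ht⟩

/-- **The certified final box**: every solution from `y₀ ∈ W₀` on `[0, τ_N]` has `y(τ_N) ∈ W_N`.
[cite: Moore1979, §8.1 eq. (8.13)] [cite: NedialkovJacksonCorliss1999, §5 Algorithm I] -/
theorem mem_final (hc : c.check = true) {y₀ : Fin n → ℝ} (hy₀ : y₀ ∈ boxSet (castBox (c.initAt 0)))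
    {y : ℝ → Fin n → ℝ} (hy0 : y 0 = y₀)
    (hy : ∀ t ∈ Icc 0 (c.toHOEChain.mesh c.size),
      HasDerivWithinAt y (fieldFun c.field (y t)) (Icc 0 (c.toHOEChain.mesh c.size)) t) :
    y (c.toHOEChain.mesh c.size) ∈ boxSet (castBox c.final) := by
  have h := ((sound hc hy₀).2 y hy0 hy).1 c.size le_rfl
  change y _ ∈ boxSet (castBox (c.toHOEChain.initAt c.toHOEChain.size)) at h
  rwa [HOEChainCert.initAt_size] at h

/-- Every point of the horizon of a nondecreasing mesh lies in some step interval. [folklore] -/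
private theorem exists_step_of_mem_Icc {τ : ℕ → ℝ} (hτ0 : τ 0 = 0) :
    ∀ {N : ℕ}, (∀ j < N, τ j ≤ τ (j + 1)) → 0 < N → ∀ {t : ℝ}, t ∈ Icc 0 (τ N) →
      ∃ j < N, t ∈ Icc (τ j) (τ (j + 1))
  | 0, _, hN, _, _ => absurd hN (lt_irrefl 0)
  | N + 1, hτ, _, t, ht => by
      by_cases htN : τ N ≤ t
      · exact ⟨N, Nat.lt_succ_self N, htN, ht.2⟩
      · rcases Nat.eq_zero_or_pos N with rfl | hN
        · exact absurd (hτ0 ▸ ht.1) htN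
        · obtain ⟨j, hj, hjt⟩ := exists_step_of_mem_Icc hτ0 (fun j hj' => hτ j (hj'.trans N.lt_succ_self))
            hN (t := t) ⟨ht.1, le_of_lt (not_le.mp htN)⟩
          exact ⟨j, hj.trans N.lt_succ_self, hjt⟩

/-- **The domain certificate along the chain**: every solution from `y₀ ∈ W₀` on `[0, τ_N]`
(`N ≥ 1`) stays in the natural domain of the field — no denominator vanishes and every argument
of `log`/`√` stays positive along it (the derived program was carried out over every `Sⱼ`).
[cite: Moore1979, §3.4 (last paragraph)] [cite: Moore1979, §8.1 eq. (8.13)] -/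
theorem mem_dom (hc : c.check = true) (hN : 0 < c.size) {y₀ : Fin n → ℝ}
    (hy₀ : y₀ ∈ boxSet (castBox (c.initAt 0))) {y : ℝ → Fin n → ℝ} (hy0 : y 0 = y₀)
    (hy : ∀ t ∈ Icc 0 (c.toHOEChain.mesh c.size),
      HasDerivWithinAt y (fieldFun c.field (y t)) (Icc 0 (c.toHOEChain.mesh c.size)) t)
    {t : ℝ} (ht : t ∈ Icc 0 (c.toHOEChain.mesh c.size)) : ∀ i, (c.field i).dom (y t) := by
  obtain ⟨j, hj, hjt⟩ := exists_step_of_mem_Icc (τ := c.toHOEChain.mesh) HOEChainCert.mesh_zero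
    (fun j hj => by
      rw [HOEChainCert.mesh_succ]
      exact le_add_of_nonneg_right (EStepCert.check_spec (check_stage hc hj).1).2.1) hN ht
  have hS := (((sound hc hy₀).2 y hy0 hy).2 j hj t hjt).1
  exact fun i => (mem_domOpens.mp (EStepCert.apriori_subset_dom (check_stage hc hj).1 hS)) i

end EChainCert

end Chain

/-! ### The chain certificate as a `Verifier` -/

section VerifierPackaging

variable {n : ℕ}

/-- A **chain instance for an elementary field**: code lists, initial box `W₀`, horizon `T` and
the claimed enclosure `F` of the values at time `T`; the certificate is the precision of the
derived program together with the list of stages produced by an untrusted validated integrator.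
[cite: NedialkovJacksonCorliss1999, §5 Algorithm I] [cite: Moore1979, §3.4 procedure steps 1–4] -/
structure EChainInstance (n : ℕ) where
  /-- The vector field, one code list per component. -/
  field : Fin n → FExpr n
  /-- The box of initial values. -/
  init : Fin n → Iv
  /-- The horizon `T`. -/
  horizon : ℚ
  /-- The claimed enclosure of `y(T)`. -/
  final : Fin n → Iv

/-- The claim of a chain instance: from every real `y₀ ∈ W₀` a solution exists on `[0, T]`, and
every solution from `y₀` on `[0, T]` has `y(T) ∈ F`. [cite: Moore1979, §8.1 eq. (8.13)] -/
def EChainInstance.Claim (I : EChainInstance n) : Prop :=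
  ∀ y₀ ∈ boxSet (castBox I.init),
    (∃ y : ℝ → Fin n → ℝ, y 0 = y₀ ∧
        ∀ t ∈ Icc 0 (I.horizon : ℝ),
          HasDerivWithinAt y (fieldFun I.field (y t)) (Icc 0 (I.horizon : ℝ)) t) ∧
      ∀ y : ℝ → Fin n → ℝ, y 0 = y₀ →
        (∀ t ∈ Icc 0 (I.horizon : ℝ),
            HasDerivWithinAt y (fieldFun I.field (y t)) (Icc 0 (I.horizon : ℝ)) t) →
          y I.horizon ∈ boxSet (castBox I.final)

/-- The chain certificate assembled from an instance, a precision and a list of stages.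
[cite: NedialkovJacksonCorliss1999, §5 Algorithm I] -/
def EChainInstance.withStages (I : EChainInstance n) (cfg : SeedCfg) (l : List (HOEStage n)) :
    EChainCert n :=
  ⟨I.field, cfg, l, I.final⟩

/-- **The elementary step-chain certificate as a `Verifier`**: accept iff `W₀ ⊆` the first
stage's box, the steps sum to the horizon, and the chain check passes; soundness =
`EChainCert.sound` / `mem_final`. [cite: Moore1979, §8.1 eq. (8.13)]
[cite: NedialkovJacksonCorliss1999, §5 Algorithm I] -/
def eChainVerifier (n : ℕ) : Verifier (EChainInstance n) EChainInstance.Claim where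
  Cert := SeedCfg × List (HOEStage n)
  check I p :=
    boxLE I.init ((I.withStages p.1 p.2).initAt 0) &&
      decide ((I.withStages p.1 p.2).toHOEChain.meshQ p.2.length = I.horizon) &&
      (I.withStages p.1 p.2).check
  sound I p h := by
    simp only [Bool.and_eq_true, decide_eq_true_eq] at h
    obtain ⟨⟨h0, hT⟩, hc⟩ := h
    have hT' : (I.horizon : ℝ) =
        (I.withStages p.1 p.2).toHOEChain.mesh (I.withStages p.1 p.2).size := by
      rw [← hT, HOEChainCert.cast_meshQ]; rfl
    intro y₀ hy₀
    have hy₀' : y₀ ∈ boxSet (castBox ((I.withStages p.1 p.2).initAt 0)) :=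
      boxSet_mono (castBox_mono (le_of_boxLE h0)) hy₀
    refine ⟨?_, fun y hy0 hy => ?_⟩
    · obtain ⟨y, hy0, hy⟩ := (EChainCert.sound hc hy₀').1
      exact ⟨y, hy0, by rw [hT']; exact hy⟩
    · rw [hT'] at hy ⊢
      exact EChainCert.mem_final hc hy₀' hy0 hy

end VerifierPackaging

/-! ### The pendulum continued over eight steps, replayed by the kernel -/

section PendulumChain

/-- **The stages** of the transcript: eight steps of `h = 1/8` at order `6`; `W₀ = {(1, 0)}`, the
hand-over boxes `W₁, …, W₇` (end boxes rounded outward to `10⁻⁷`) and the a-priori boxes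
`S₀, …, S₇` (grid `10⁻⁴`) were produced by an untrusted search.
[cite: Moore1979, §8.1 eq. (8.13)] [cite: NedialkovJacksonCorliss1999, §5 Algorithm I] -/
def pendulumStages : List (HOEStage 2) :=
  [⟨6, 1 / 8, ![pure 1, pure 0],
      ![⟨(9923 / 10000, 10021 / 10000), by decide +kernel⟩, ⟨(-1073 / 10000, 31 / 10000), by decide +kernel⟩]⟩,
   ⟨6, 1 / 8, ![⟨(9934306 / 10000000, 9934307 / 10000000), by decide +kernel⟩, ⟨(-1050355 / 10000000, -1050354 / 10000000), by decide +kernel⟩],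
      ![⟨(9725 / 10000, 9958 / 10000), by decide +kernel⟩, ⟨(-2119 / 10000, -1019 / 10000), by decide +kernel⟩]⟩,
   ⟨6, 1 / 8, ![⟨(9737785 / 10000000, 9737787 / 10000000), by decide +kernel⟩, ⟨(-2091714 / 10000000, -2091712 / 10000000), by decide +kernel⟩],
      ![⟨(9398 / 10000, 9762 / 10000), by decide +kernel⟩, ⟨(-3146 / 10000, -2060 / 10000), by decide +kernel⟩]⟩,
   ⟨6, 1 / 8, ![⟨(9412144 / 10000000, 9412148 / 10000000), by decide +kernel⟩, ⟨(-3114627 / 10000000, -3114624 / 10000000), by decide +kernel⟩],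
      ![⟨(8945 / 10000, 9438 / 10000), by decide +kernel⟩, ⟨(-4146 / 10000, -3078 / 10000), by decide +kernel⟩]⟩,
   ⟨6, 1 / 8, ![⟨(8960323 / 10000000, 8960329 / 10000000), by decide +kernel⟩, ⟨(-4108787 / 10000000, -4108782 / 10000000), by decide +kernel⟩],
      ![⟨(8369 / 10000, 8987 / 10000), by decide +kernel⟩, ⟨(-5105 / 10000, -4066 / 10000), by decide +kernel⟩]⟩,
   ⟨6, 1 / 8, ![⟨(8386620 / 10000000, 8386628 / 10000000), by decide +kernel⟩, ⟨(-5062730 / 10000000, -5062723 / 10000000), by decide +kernel⟩],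
      ![⟨(7678 / 10000, 8415 / 10000), by decide +kernel⟩, ⟨(-6013 / 10000, -5014 / 10000), by decide +kernel⟩]⟩,
   ⟨6, 1 / 8, ![⟨(7696846 / 10000000, 7696856 / 10000000), by decide +kernel⟩, ⟨(-5963688 / 10000000, -5963679 / 10000000), by decide +kernel⟩],
      ![⟨(6878 / 10000, 7726 / 10000), by decide +kernel⟩, ⟨(-6853 / 10000, -5908 / 10000), by decide +kernel⟩]⟩,
   ⟨6, 1 / 8, ![⟨(6898488 / 10000000, 6898500 / 10000000), by decide +kernel⟩, ⟨(-6797647 / 10000000, -6797635 / 10000000), by decide +kernel⟩],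
      ![⟨(5979 / 10000, 6929 / 10000), by decide +kernel⟩, ⟨(-7612 / 10000, -6735 / 10000), by decide +kernel⟩]⟩]

/-- **The instance**: the pendulum `x₁' = x₂`, `x₂' = −sin x₁` (`pendulumField`) from the point
box `{(1, 0)}`, horizon `1`, claimed final box `[0.6000848, 0.6000863] × [−0.7549644, −0.7549629]`.
[cite: Moore1979, §8.1 eq. (8.13)] [cite: Moore1979, §3.4 eq. (3.19)] -/
def pendulumInstance : EChainInstance 2 :=
  ⟨pendulumField, ![pure 1, pure 0], 1,
    ![⟨(6000848 / 10000000, 6000863 / 10000000), by decide +kernel⟩, ⟨(-7549644 / 10000000, -7549629 / 10000000), by decide +kernel⟩]⟩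

/-- **The transcript**: the instance with the derived program at `40`-bit outward rounding and
seeds at scale `2^30` (`12` terms, `3` halvings), and the eight stages.
[cite: Moore1979, §8.1 eq. (8.13)] [cite: Moore1979, §3.4 procedure steps 1–4] -/
def pendulumChain : EChainCert 2 := pendulumInstance.withStages ⟨40, 30, 12, 3, 0⟩ pendulumStages

/-- **The kernel accepts the eight-step transcript.** [cite: Moore1979, §8.1 eq. (8.13)] -/
theorem pendulumChain_check : pendulumChain.check = true := by
  decide +kernel

/-- The transcript has eight steps. [cite: Moore1979, §8.1 eq. (8.13)] -/
theorem pendulumChain_size : pendulumChain.size = 8 := rfl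

/-- Its horizon is `τ₈ = 1`, in exact rational arithmetic. [cite: Moore1979, §8.1 eq. (8.13)]
[cite: Moore1966, §4.4] -/
theorem pendulumChain_meshQ : pendulumChain.toHOEChain.meshQ 8 = 1 := by
  simp only [HOEChainCert.meshQ, Finset.sum_range_succ, Finset.sum_range_zero,
    HOEChainCert.stageAt, EChainCert.toHOEChain, pendulumChain, pendulumInstance, pendulumStages,
    EChainInstance.withStages, List.getD_cons_zero, List.getD_cons_succ]
  norm_num

/-- Its horizon is `τ₈ = 1`. [cite: Moore1979, §8.1 eq. (8.13)] -/
theorem pendulumChain_mesh : pendulumChain.toHOEChain.mesh 8 = 1 := by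
  rw [← HOEChainCert.cast_meshQ, pendulumChain_meshQ, Rat.cast_one]

/-- The half-way mesh point is `τ₄ = 1/2`. [cite: Moore1979, §8.1 eq. (8.13)] -/
theorem pendulumChain_mesh_four : pendulumChain.toHOEChain.mesh 4 = 1 / 2 := by
  rw [← HOEChainCert.cast_meshQ]
  simp only [HOEChainCert.meshQ, Finset.sum_range_succ, Finset.sum_range_zero,
    HOEChainCert.stageAt, EChainCert.toHOEChain, pendulumChain, pendulumInstance, pendulumStages,
    EChainInstance.withStages, List.getD_cons_zero, List.getD_cons_succ]
  norm_num

/-- The initial value `(1, 0)` lies in (is) `W₀`. [cite: Moore1979, §8.1 eq. (8.13)] -/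
theorem pendulumChain_init_mem :
    (![1, 0] : Fin 2 → ℝ) ∈ boxSet (castBox (pendulumChain.initAt 0)) := by
  rw [mem_boxSet_iff]
  intro i
  fin_cases i
  · show (1 : ℝ) ∈ (NonemptyInterval.pure (1 : ℚ)).ratCast ℝ
    rw [ratCast_pure, Rat.cast_one]; exact mem_pure_self _
  · show (0 : ℝ) ∈ (NonemptyInterval.pure (0 : ℚ)).ratCast ℝ
    rw [ratCast_pure, Rat.cast_zero]; exact mem_pure_self _

/-- **Existence on `[0, 1]`** (kernel-certified): the pendulum with `x(0) = (1, 0)` has a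
solution on `[0, 1]`. [cite: Moore1979, §8.1 eq. (8.13)] -/
theorem pendulumChain_exists :
    ∃ y : ℝ → Fin 2 → ℝ, y 0 = ![1, 0] ∧
      ∀ t ∈ Icc (0 : ℝ) 1,
        HasDerivWithinAt y (fieldFun pendulumField (y t)) (Icc (0 : ℝ) 1) t := by
  have h := (EChainCert.sound pendulumChain_check pendulumChain_init_mem).1
  rwa [pendulumChain_size, pendulumChain_mesh] at h

/-- **Enclosure at `t = 1`** (kernel-certified): every solution of the pendulum from `(1, 0)` on
`[0, 1]` has `x(1) ∈ [0.6000848, 0.6000863] × [−0.7549644, −0.7549629]` (widths `1.5·10⁻⁶`).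
[cite: Moore1979, §8.1 eq. (8.13)] -/
theorem pendulumChain_final {z : ℝ → Fin 2 → ℝ} (hz0 : z 0 = ![1, 0])
    (hz : ∀ t ∈ Icc (0 : ℝ) 1,
      HasDerivWithinAt z (fieldFun pendulumField (z t)) (Icc (0 : ℝ) 1) t) :
    z 1 ∈ boxSet (castBox pendulumInstance.final) := by
  have h := fun hz' =>
    EChainCert.mem_final pendulumChain_check pendulumChain_init_mem hz0 hz'
  rw [pendulumChain_size, pendulumChain_mesh] at h
  exact h hz

/-- **Enclosure at the mesh point `t = 1/2`** (kernel-certified): every solution of the pendulum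
from `(1, 0)` on `[0, 1]` has `x(1/2) ∈ W₄ = [0.8960323, 0.8960329] × [−0.4108787, −0.4108782]`.
[cite: Moore1979, §8.1 eq. (8.13)] -/
theorem pendulumChain_half {z : ℝ → Fin 2 → ℝ} (hz0 : z 0 = ![1, 0])
    (hz : ∀ t ∈ Icc (0 : ℝ) 1,
      HasDerivWithinAt z (fieldFun pendulumField (z t)) (Icc (0 : ℝ) 1) t) :
    z (1 / 2) ∈ boxSet (castBox (pendulumChain.initAt 4)) := by
  have h := fun hz' =>
    ((EChainCert.sound pendulumChain_check pendulumChain_init_mem).2 z hz0 hz').1 4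
  rw [pendulumChain_size, pendulumChain_mesh, pendulumChain_mesh_four] at h
  exact h hz (by norm_num)

/-- **No singularity is met** (kernel-certified domain certificate; trivial for this field, whose
natural domain is everything, but produced by the same check for fields with `÷`, `log`, `√`).
[cite: Moore1979, §3.4 (last paragraph)] -/
theorem pendulumChain_dom {z : ℝ → Fin 2 → ℝ} (hz0 : z 0 = ![1, 0])
    (hz : ∀ t ∈ Icc (0 : ℝ) 1,
      HasDerivWithinAt z (fieldFun pendulumField (z t)) (Icc (0 : ℝ) 1) t)
    {t : ℝ} (ht : t ∈ Icc (0 : ℝ) 1) : ∀ i, (pendulumField i).dom (z t) := by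
  have h := fun hz' ht' =>
    EChainCert.mem_dom pendulumChain_check (by decide) pendulumChain_init_mem hz0 hz' (t := t) ht'
  rw [pendulumChain_size, pendulumChain_mesh] at h
  exact h hz ht

/-- **The verifier's claim for the instance** (existence on `[0, 1]` from every point of `W₀` and
`x(1) ∈ F` for every solution), extracted from `eChainVerifier` with (precision, stages) as the
certificate; the verifier's own landing and horizon tests are discharged by `decide` and
`pendulumChain_meshQ`, the chain check is `pendulumChain_check`.
[cite: NedialkovJacksonCorliss1999, §5 Algorithm I] [cite: Moore1979, §8.1 eq. (8.13)] -/
theorem pendulumChain_claim : pendulumInstance.Claim := by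
  refine (eChainVerifier 2).sound (c := (⟨40, 30, 12, 3, 0⟩, pendulumStages)) ?_
  show (boxLE pendulumInstance.init (pendulumChain.initAt 0) &&
      decide (pendulumChain.toHOEChain.meshQ pendulumStages.length = pendulumInstance.horizon) &&
        pendulumChain.check) = true
  rw [pendulumChain_check, Bool.and_true, Bool.and_eq_true]
  exact ⟨by decide +kernel, decide_eq_true pendulumChain_meshQ⟩

end PendulumChain

end Literature.Analysis.ODE
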